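import Literature.ModelTheory.FiniteModelTheory.CountingLogic

/-!
# Type refinement (bijective-pebble / `k`-dimensional Weisfeiler–Leman refinement across two
# structures) and the EASY half of its completeness: equal refined types ⇒ Duplicator wins

Everything PROVED; no named facts. For `L`-structures `M`, `N` and `k`-tuples `v : Fin k → M`,
`w : Fin k → N`:

* `AtomEq v w` — equal ATOMIC types (the same equalities and the same relations on sub-tuples);
* `TEq L r v w` — the REFINED type equality after `r` rounds: `TEq 0 = AtomEq`, and
  `TEq (r+1) v w` iff `TEq r v w` and for every pebble `i` some bijection `f : M ≃ N` matches the
  one-point extensions, `TEq r (v[a/i]) (w[f a/i])` for all `a` — the bijective-pebble-game form of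
  the `k`-WL refinement step "same colour and same multiset of colours of one-point modifications"
  (Cai–Fürer–Immerman 1992, §5; Hella 1996);
* `TEq.exists_stable` — on finite structures the refinement STABILISES: from some round `R` on,
  `TEq R ⇒ TEq r` for all `r ≥ R`;
* `structCkEquiv_of_tEq` — **if some pair of tuples has equal refined types at every round then
  `M ≡^{C^k} N`** (`StructCkEquiv`, the tree's bijective `k`-pebble game): the positions extended
  by some pair with eternally equal types form a strategy space of partial isomorphisms
  (Cai–Fürer–Immerman 1992, proof of Thm 5.2, (2) ⇒ (3); the hard direction is not needed here).

Consumer: the powerset Held–Karp collapse for crux `WindowHam` (route PneNP/SymmetryBudget,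
stmt-PneNP-2143): with `HeldKarpDefinability.lean` (Hamiltonicity is `C^7`-invariant over the
powerset expansion), any circuit family computing cross-structure-canonical NAMES of the refined
types of the expansion decides Hamiltonicity up to a decoder; this file is the game-theoretic half
of that step, leaving only the circuit construction.

## References

* J.-Y. Cai, M. Fürer, N. Immerman, Combinatorica 12 (1992), §5, Thm 5.2 (stable colourings of
  `k`-tuples vs the `C^{k}` pebble game).
* L. Hella, Inform. and Comput. 129 (1996) (the bijective pebble game).
* A. Atserias, A. Dawar, J. Logic Comput. 29 (2019), §2.1.
-/

namespace Literature.ModelTheory.FiniteModelTheory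

open FirstOrder FirstOrder.Language.Structure

universe u v w w'

variable {L : FirstOrder.Language.{u, v}} {k : ℕ} {M : Type w} {N : Type w'}
  [L.Structure M] [L.Structure N]

/-- **Equal atomic types**: the tuples `v`, `w` satisfy the same equalities between coordinates
and the same relations on coordinate sub-tuples. [cite: CaiFurerImmerman1992, §5] -/
def AtomEq (L : FirstOrder.Language.{u, v}) [L.Structure M] [L.Structure N]
    (v : Fin k → M) (w : Fin k → N) : Prop :=
  (∀ i j : Fin k, v i = v j ↔ w i = w j) ∧
    ∀ ⦃r : ℕ⦄ (R : L.Relations r) (t : Fin r → Fin k), RelMap R (v ∘ t) ↔ RelMap R (w ∘ t)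

/-- **Refined type equality after `r` rounds** (bijective-pebble / `k`-WL refinement across two
structures): round `0` is atomic type equality; round `r + 1` asks in addition, for every
coordinate `i`, for a bijection `M ≃ N` matching the round-`r` types of all one-point
modifications at `i`. [cite: CaiFurerImmerman1992, §5] -/
def TEq (L : FirstOrder.Language.{u, v}) [L.Structure M] [L.Structure N] :
    ℕ → (Fin k → M) → (Fin k → N) → Prop
  | 0 => fun v w => AtomEq L v w
  | r + 1 => fun v w => TEq L r v w ∧ ∀ i : Fin k, ∃ f : M ≃ N,
      ∀ a : M, TEq L r (Function.update v i a) (Function.update w i (f a))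

/-- One more round refines. [folklore] -/
theorem TEq.of_succ {r : ℕ} {v : Fin k → M} {w : Fin k → N} (h : TEq L (r + 1) v w) : TEq L r v w :=
  h.1

/-- Refinement is antitone in the number of rounds. [folklore] -/
theorem TEq.anti {r s : ℕ} (hrs : r ≤ s) {v : Fin k → M} {w : Fin k → N} (h : TEq L s v w) :
    TEq L r v w := by
  induction s with
  | zero =>
    have : r = 0 := Nat.le_zero.1 hrs
    subst this
    exact h
  | succ s ih =>
    rcases Nat.lt_or_eq_of_le hrs with hlt | rfl
    · exact ih (Nat.lt_succ_iff.1 hlt) h.1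
    · exact h

/-- Refined types refine atomic types. [folklore] -/
theorem TEq.atomEq {r : ℕ} {v : Fin k → M} {w : Fin k → N} (h : TEq L r v w) : AtomEq L v w :=
  TEq.anti (Nat.zero_le r) h

/-- Atomic type equality is reflexive. [folklore] -/
theorem AtomEq.refl (v : Fin k → M) : AtomEq L v v :=
  ⟨fun _ _ => Iff.rfl, fun _ _ _ => Iff.rfl⟩

/-- Atomic type equality is symmetric. [folklore] -/
theorem AtomEq.symm {v : Fin k → M} {w : Fin k → N} (h : AtomEq L v w) : AtomEq L w v :=
  ⟨fun i j => (h.1 i j).symm, fun _ R t => (h.2 R t).symm⟩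

/-- Atomic type equality is transitive (across three structures). [folklore] -/
theorem AtomEq.trans {P : Type*} [L.Structure P] {u : Fin k → P} {v : Fin k → M} {w : Fin k → N}
    (h₁ : AtomEq L u v) (h₂ : AtomEq L v w) : AtomEq L u w :=
  ⟨fun i j => (h₁.1 i j).trans (h₂.1 i j), fun _ R t => (h₁.2 R t).trans (h₂.2 R t)⟩

/-- Refined type equality is reflexive (Duplicator copies). [folklore] -/
theorem TEq.refl : ∀ (r : ℕ) (v : Fin k → M), TEq L r v v
  | 0, v => AtomEq.refl v
  | r + 1, v => ⟨TEq.refl r v, fun _ => ⟨Equiv.refl M, fun _ => TEq.refl r _⟩⟩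

/-- Refined type equality is symmetric. [folklore] -/
theorem TEq.symm : ∀ {r : ℕ} {v : Fin k → M} {w : Fin k → N}, TEq L r v w → TEq L r w v
  | 0, _, _, h => AtomEq.symm h
  | r + 1, _, _, h => ⟨TEq.symm h.1, fun i => by
      obtain ⟨f, hf⟩ := h.2 i
      refine ⟨f.symm, fun b => ?_⟩
      have := TEq.symm (hf (f.symm b))
      rwa [Equiv.apply_symm_apply] at this⟩

/-- Refined type equality is transitive across three structures (so, round by round, an
equivalence relation on the disjoint union of the tuple spaces — the classes are the "colours").
[folklore] -/
theorem TEq.trans {P : Type*} [L.Structure P] :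
    ∀ {r : ℕ} {u : Fin k → P} {v : Fin k → M} {w : Fin k → N}, TEq L r u v → TEq L r v w → TEq L r u w
  | 0, _, _, _, h₁, h₂ => AtomEq.trans h₁ h₂
  | r + 1, _, _, _, h₁, h₂ => ⟨TEq.trans h₁.1 h₂.1, fun i => by
      obtain ⟨f, hf⟩ := h₁.2 i
      obtain ⟨g, hg⟩ := h₂.2 i
      exact ⟨f.trans g, fun a => TEq.trans (hf a) (hg (f a))⟩⟩

/-- **Stabilisation on finite structures**: from some round `R` on the refinement is constant
(`TEq R ⇒ TEq r` for all `r ≥ R`). [cite: CaiFurerImmerman1992, §5 (stable colouring)] -/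
theorem TEq.exists_stable [Finite M] [Finite N] (L : FirstOrder.Language.{u, v}) [L.Structure M]
    [L.Structure N] (k : ℕ) :
    ∃ R : ℕ, ∀ r : ℕ, R ≤ r → ∀ (v : Fin k → M) (w : Fin k → N), TEq L R v w → TEq L r v w := by
  classical
  let S : ℕ → Set ((Fin k → M) × (Fin k → N)) := fun r => {p | TEq L r p.1 p.2}
  have hanti : ∀ {r s}, r ≤ s → S s ⊆ S r := fun hrs p hp => TEq.anti hrs hp
  let c : ℕ → ℕ := fun r => (S r).ncard
  -- a round minimising the number of equal-type pairs
  have hmin : ∃ R, ∀ r, c R ≤ c r := by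
    have hne : (Set.range c).Nonempty := ⟨c 0, 0, rfl⟩
    obtain ⟨n, ⟨R, rfl⟩, hR⟩ := Nat.lt_wfRel.wf.has_min (Set.range c) hne
    exact ⟨R, fun r => Nat.not_lt.1 (hR (c r) ⟨r, rfl⟩)⟩
  obtain ⟨R, hR⟩ := hmin
  refine ⟨R, fun r hRr v w hvw => ?_⟩
  have hsub : S r ⊆ S R := hanti hRr
  have heq : S r = S R := Set.eq_of_subset_of_ncard_le hsub (hR r) (Set.toFinite _)
  have : (v, w) ∈ S R := hvw
  rw [← heq] at this
  exact this

/-- The positions of the strategy space: those extended by a pair of tuples with equal refined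
types at every round. [cite: CaiFurerImmerman1992, proof of Thm 5.2] -/
def refinementPositions (L : FirstOrder.Language.{u, v}) [L.Structure M] [L.Structure N]
    (k : ℕ) : Set (PebblePosition k M N) :=
  {p | ∃ (v : Fin k → M) (w : Fin k → N), p.Extends v w ∧ ∀ r, TEq L r v w}

/-- Positions extended by an atomically-equal pair are partial isomorphisms. [folklore] -/
theorem isPartialIso_of_extends_atomEq {p : PebblePosition k M N} {v : Fin k → M} {w : Fin k → N}
    (hext : p.Extends v w) (hat : AtomEq L v w) : p.IsPartialIso L := by
  classical
  refine ⟨fun a a' b b' ⟨j, hj⟩ ⟨j', hj'⟩ => ?_, fun r R a b hab => ?_⟩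
  · obtain ⟨rfl, rfl⟩ := hext hj
    obtain ⟨rfl, rfl⟩ := hext hj'
    exact hat.1 j j'
  · choose t ht using hab
    have ha : v ∘ t = a := funext fun j => (hext (ht j)).1
    have hb : w ∘ t = b := funext fun j => (hext (ht j)).2
    have := hat.2 R t
    rwa [ha, hb] at this

/-- **Equal refined types at every round ⇒ `≡^{C^k}`** (finite structures): if some `k`-tuples
`v₀`, `w₀` of `M`, `N` satisfy `TEq L r v₀ w₀` for every `r`, Duplicator wins the bijective
`k`-pebble game. (Cai–Fürer–Immerman 1992, Thm 5.2, the direction (stable colouring) ⇒ (game): at a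
move on pebble `i` Duplicator plays the bijection of the stable round; types stay equal forever.)
[cite: CaiFurerImmerman1992, Thm 5.2] -/
theorem structCkEquiv_of_tEq [Finite M] [Finite N] (v₀ : Fin k → M) (w₀ : Fin k → N)
    (h : ∀ r, TEq L r v₀ w₀) : StructCkEquiv L k M N := by
  obtain ⟨R, hR⟩ := TEq.exists_stable (M := M) (N := N) L k
  refine ⟨⟨refinementPositions L k, ?_, ?_⟩, ?_⟩
  · refine ⟨v₀, w₀, ?_, h⟩
    intro j a b hj
    simp [PebblePosition.empty] at hj
  · rintro p ⟨v, w, hext, hall⟩ i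
    obtain ⟨f, hf⟩ := (hall (R + 1)).2 i
    refine ⟨f, fun a => ⟨Function.update v i a, Function.update w i (f a), ?_, fun r => ?_⟩⟩
    · intro j a' b' hj
      by_cases hji : j = i
      · subst hji
        rw [Function.update_self] at hj
        cases hj
        simp
      · rw [Function.update_of_ne hji] at hj
        rw [Function.update_of_ne hji, Function.update_of_ne hji]
        exact hext hj
    · rcases le_or_gt r R with hr | hr
      · exact TEq.anti hr (hf a)
      · exact hR r hr.le _ _ (hf a)
  · rintro p ⟨v, w, hext, hall⟩
    exact isPartialIso_of_extends_atomEq hext (hall 0).atomEq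

/-- Variant keyed on the CONSTANT tuples (the usual start of the game on nonempty structures): if
for some `a₀ ∈ M`, `b₀ ∈ N` the constant tuples have equal refined types at every round, then
`M ≡^{C^k} N`. [cite: CaiFurerImmerman1992, Thm 5.2] -/
theorem structCkEquiv_of_tEq_const [Finite M] [Finite N] (a₀ : M) (b₀ : N)
    (h : ∀ r, TEq L r (fun _ : Fin k => a₀) (fun _ : Fin k => b₀)) : StructCkEquiv L k M N :=
  structCkEquiv_of_tEq _ _ h

end Literature.ModelTheory.FiniteModelTheory
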